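import Summits.CriticalPhenomena.PercolationContinuityZ3.Theorems.SahiMasterFamilyBernsteinPos

/-!
# LABEL TRANSPORT: the removal-with-transport map on labelled permutations, its union-closure lemma, and the typed matching
# conjecture (TM) behind conjecture (B)

Unit `prim-masterthm-p4` (gen 24; crux anchor stmt-CriticalPhenomena-4575, helper work; memo
`run/shared/lean/prim/prim-masterthm/prim-masterthm-p4/P4-GEN24-REPORT.md` §8).  Companion of `…BernsteinPos` / `…UCBernstein` (typed conjecture (B):
the degree-`k` Bernstein coefficients of the edge polynomial `w ↦ Φ_k(w·1_𝒰 + (1−w)·1_𝒱)` of two union-closed families are `≥ 0`) and `…CBar`.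

THE COMBINATORIAL MODEL (memo §8).  A CONFIGURATION on `Fin (n+1)` is a pair `(σ, λ)` of a permutation and a point labelling `λ : Fin (n+1) → Bool`
(`false` = family `𝒰`, `true` = family `𝒱`).  A cycle `C` of `σ` (as a set, `CycleForm.orbit`) is labelled by the label of its MINIMUM and is BAD when
`C ∉ 𝒳_{λ(min C)}` (`badSet`); the configuration is ALL-BAD when every cycle is bad (`AllBad`).  In this model the Bernstein coefficient of index `s` of
the edge polynomial is the difference of two counts (complement form of `Φ`, memo (I5); NOT formalised here):
  `N_s = #{(y, c′) : c′ all-bad off the fixed point y, s labels true} − #{c all-bad, s labels true}`,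
so conjecture (B) for the pair is the count inequality "all-bad configurations ≤ pointed all-bad configurations one point down", layer by layer.
REMOVAL WITH TRANSPORT (`remove y c`): short-cut `y` out of its cycle (`swap y (σ y) * σ`) and, if `y` was the minimum of a cycle of length `≥ 2`, SWAP
the labels of `y` and of the new minimum — the cycle keeps its label, `y` becomes a fixed point carrying a free label, the label count is unchanged
(`layer_remove`).  **KEY LEMMA (`erase_mem_unique`)**: in a union-closed family a non-member `D` has at most one point `x` with `D.erase x` a member (two
such erasures would union to `D`).  Hence (memo §8) every all-bad configuration has at least `#fixed points + Σ_{|C|≥2}(|C|−1)` removals that stay all-bad.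

**CONJECTURE (TM) (`TransportMatching n`, typed; memo §8):** for union-closed `𝒰, 𝒱 ∋ univ` and every layer `s` there is a choice of removal point
`f c` for every all-bad configuration `c` of layer `s` such that `remove (f c) c` is all-bad off `f c` and `c ↦ (f c, remove (f c) c)` is injective —
a left-saturating matching of the removal graph.  With the (unformalised) count identity above, (TM) gives conjecture (B) for the pair by pure counting;
the same construction with `m` label values gives the multi-family (B) (`UCBernsteinNonneg`) and hence `(UC-hull)_k` for every `k`.
EVIDENCE (P4-GEN24-REPORT §8, exact maximum matchings): 0 Hall deficits for all tested pairs on ≤ 7 points (40 000+ ordered orbit-pairs on 4 points,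
2 800 on 5, 5 000 on 6, structured/extremal families on 6–7) and for 3- and 4-family tuples on ≤ 6 points; WITHOUT transport Hall fails from 4 points on.
HONEST FRAMING: definitions, the one-line union-closure lemma, label-count invariance, and a typed conjecture; the count identity linking (TM) to `BPos`,
(TM) itself, (B), `UCHullNonneg k` (k ≥ 8), Sahi's `C_k` and the master theorem remain OPEN / unformalised.  Axioms standard. [this work]
-/

noncomputable section

open scoped Classical

namespace Summit.CriticalPhenomena.PercolationContinuityZ3.Theorems

namespace LabelTransport

open Finset Function Equiv
open Literature.Combinatorics.Sahi2008.CycleForm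

variable {n : ℕ}

/-! ### The union-closure lemma -/

/-- **Key lemma.**  In a union-closed family, a non-member `D` has at most one point whose erasure is a member: if `D.erase x ∈ 𝒳` and
`D.erase x' ∈ 𝒳` with `x ≠ x'` then `D = (D.erase x) ∪ (D.erase x') ∈ 𝒳`. [this work] -/
theorem erase_mem_unique {α : Type*} [DecidableEq α] {𝒳 : Finset (Finset α)} (hX : ∀ A ∈ 𝒳, ∀ B ∈ 𝒳, A ∪ B ∈ 𝒳)
    {D : Finset α} (hD : D ∉ 𝒳) {x x' : α} (hx : D.erase x ∈ 𝒳) (hx' : D.erase x' ∈ 𝒳) : x = x' := by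
  by_contra hne
  apply hD
  have hU : D.erase x ∪ D.erase x' = D := by
    ext a
    simp only [mem_union, mem_erase]
    constructor
    · rintro (⟨_, ha⟩ | ⟨_, ha⟩) <;> exact ha
    · intro ha
      by_cases hax : a = x
      · exact Or.inr ⟨fun h => hne (hax.symm.trans h), ha⟩
      · exact Or.inl ⟨hax, ha⟩
  rw [← hU]
  exact hX _ hx _ hx'

/-! ### Configurations, cycle labels, badness -/

/-- A configuration: a permutation of `Fin (n+1)` with a Boolean point labelling (`false` ↦ `𝒰`, `true` ↦ `𝒱`). [this work] -/
abbrev Config (n : ℕ) := Perm (Fin (n + 1)) × (Fin (n + 1) → Bool)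

/-- The family selected by a label. [this work] -/
def famOf (𝒰 𝒱 : Finset (Finset (Fin (n + 1)))) (b : Bool) : Finset (Finset (Fin (n + 1))) := if b then 𝒱 else 𝒰

/-- The label of a set = the label of its minimum (junk `false` on `∅`). [this work] -/
def setLabel (lam : Fin (n + 1) → Bool) (C : Finset (Fin (n + 1))) : Bool :=
  if h : C.Nonempty then lam (C.min' h) else false

/-- A set is BAD for a labelling when it is not a member of the family selected by the label of its minimum. [this work] -/
def badSet (𝒰 𝒱 : Finset (Finset (Fin (n + 1)))) (lam : Fin (n + 1) → Bool) (C : Finset (Fin (n + 1))) : Prop :=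
  C ∉ famOf 𝒰 𝒱 (setLabel lam C)

/-- ALL-BAD configuration: every cycle (as a set, fixed points included) is bad. [this work] -/
def AllBad (𝒰 𝒱 : Finset (Finset (Fin (n + 1)))) (c : Config n) : Prop :=
  ∀ i, badSet 𝒰 𝒱 c.2 (orbit c.1 i)

/-- All-bad OFF the point `y`: `y` is a fixed point and every other cycle is bad (the pointed configurations one point down, without reindexing).
[this work] -/
def AllBadOff (𝒰 𝒱 : Finset (Finset (Fin (n + 1)))) (y : Fin (n + 1)) (c : Config n) : Prop :=
  c.1 y = y ∧ ∀ i, i ≠ y → badSet 𝒰 𝒱 c.2 (orbit c.1 i)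

/-- The layer (number of `true` = `𝒱` labels) of a configuration. [this work] -/
def layer (c : Config n) : ℕ := (univ.filter fun i => c.2 i = true).card

/-! ### Removal with label transport -/

/-- **Removal with label transport.**  Short-cut `y` out of its cycle (`swap y (σ y) * σ` sends the predecessor of `y` to `σ y` and fixes `y`); if `y` was
the minimum of a cycle with at least two points, swap the labels of `y` and of the new minimum of that cycle. [this work] -/
def remove (y : Fin (n + 1)) (c : Config n) : Config n :=
  let C := (orbit c.1 y).erase y
  (Equiv.swap y (c.1 y) * c.1,
    if h : C.Nonempty ∧ (orbit c.1 y).min' ⟨y, self_mem_orbit c.1 y⟩ = y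
    then c.2 ∘ Equiv.swap y (C.min' h.1) else c.2)

/-- After removal, `y` is a fixed point. [this work] -/
theorem remove_fix (y : Fin (n + 1)) (c : Config n) : (remove y c).1 y = y := by
  unfold remove
  simp [Perm.mul_apply, Equiv.swap_apply_right]

/-- Label transport is a swap of two point labels, so the layer is unchanged. [this work] -/
theorem layer_remove (y : Fin (n + 1)) (c : Config n) : layer (remove y c) = layer c := by
  unfold layer remove
  dsimp only
  split_ifs with h
  · -- relabelling along the involution `swap y m`
    set m := ((orbit c.1 y).erase y).min' h.1 with hm
    have e : (univ.filter fun i => (c.2 ∘ Equiv.swap y m) i = true) =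
        (univ.filter fun i => c.2 i = true).map (Equiv.swap y m).toEmbedding := by
      ext i
      simp only [mem_filter, mem_univ, true_and, comp_apply, mem_map_equiv, Equiv.symm_swap]
    rw [e, card_map]
  · rfl

/-! ### The typed conjecture -/

/-- **CONJECTURE (TM) at order `n+1`** (memo §8): for union-closed `𝒰, 𝒱 ∋ univ` and every layer `s`, some assignment of a removal point to every all-bad
configuration of layer `s` makes "remove with transport" land in the all-bad-off configurations and be injective — a left-saturating matching of the
transport removal graph.  By the complement form of `Φ` (memo (I5), not formalised) this is a bijective proof of conjecture (B) for the pair, layer by layer.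
A conjecture-valued definition, never a fact. [this work] [status: open; 0 Hall deficits in every exact test on ≤ 7 points] -/
@[conjecture] def TransportMatching (n : ℕ) : Prop :=
  ∀ 𝒰 𝒱 : Finset (Finset (Fin (n + 1))),
    (∀ A ∈ 𝒰, ∀ B ∈ 𝒰, A ∪ B ∈ 𝒰) → (∀ A ∈ 𝒱, ∀ B ∈ 𝒱, A ∪ B ∈ 𝒱) → univ ∈ 𝒰 → univ ∈ 𝒱 →
    ∀ s : ℕ, ∃ f : Config n → Fin (n + 1),
      (∀ c, AllBad 𝒰 𝒱 c → layer c = s → AllBadOff 𝒰 𝒱 (f c) (remove (f c) c)) ∧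
      (∀ c₁ c₂, AllBad 𝒰 𝒱 c₁ → AllBad 𝒰 𝒱 c₂ → layer c₁ = s → layer c₂ = s →
        f c₁ = f c₂ → remove (f c₁) c₁ = remove (f c₂) c₂ → c₁ = c₂)

/-- The trivial order: on one point (`n = 0`) every configuration is the identity with one label; the full cycle `univ = {0}` lies in both families, so
no configuration is all-bad and (TM) holds vacuously. [this work] -/
theorem transportMatching_zero : TransportMatching 0 := by
  intro 𝒰 𝒱 _ _ hU hV s
  have key : ∀ c : Config 0, AllBad 𝒰 𝒱 c → False := by
    intro c hc
    have h0 := hc 0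
    unfold badSet famOf setLabel at h0
    have horb : orbit c.1 (0 : Fin (0 + 1)) = univ := by
      ext i; simp only [mem_univ, iff_true]; rw [Fin.eq_zero i]; exact self_mem_orbit _ _
    rw [horb] at h0
    split_ifs at h0 <;> first | exact h0 hV | exact h0 hU
  exact ⟨fun _ => 0, fun c hc _ => (key c hc).elim, fun c₁ _ hc₁ _ _ _ _ _ => (key c₁ hc₁).elim⟩

end LabelTransport

end Summit.CriticalPhenomena.PercolationContinuityZ3.Theorems
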